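import Summits.MatrixMultiplication.OmegaCensus.SmallFormats.InvertiblePointNearEquivariance
import HarnessLib

/-!
# ω-census family (a): K-EQUIVARIANCE OF THE NEAR-STAGE PRUNE SYSTEM — `SOL(ω) ⇔ SOL(ω ∘ (· g))` and orbit representatives

Cell `pub-omega` (unit `pub-omega-eng1-g29`, ENG1), topic `Summits/MatrixMultiplication/OmegaCensus` (sub-folder `SmallFormats`).
Framing (verbatim): lottery ticket; floor = certified bounds/negative ranges. HONEST FRAMING: elementary linear algebra (transport of
structure along a linear automorphism), any field; it ASSEMBLES the per-constraint facts of `InvertiblePointNearEquivariance` (p527120)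
into the statement both near-stage ω-engines of the `𝔽₃` `⟨2,2,6⟩ @ 20` census rest on (tensor EQUIVARIANCE.md §3–§4, ENG1 RESULT-fp5 §3),
until now a DESK fact (×1 each side, controls C6/C7/C8). Nothing here is a bound on a rank or on `ω` the exponent.

§1 ABSTRACT SYSTEM. Unknowns `W : ι → V`; constraints: `W s ∈ L s` for candidate SETS `L s ⊆ V` (affine pieces allowed), `W` linearly
independent, and rank caps `dim span {T a s (W s) : s} ≤ cap a` (`a : A`) with LINEAR operators `T a s : V → U a` (a term outside cap `a`
has `T a s = 0`; stacked footprints map into `U a = V^p`; the span test is a cap). `PruneSol L T cap` := a witness exists. TRANSPORT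
(`PruneSol.transport`, `pruneSol_iff_of_linearEquiv`) along a linear automorphism `e` with `L' s = e '' L s`, `T' a s ∘ e = e_a ∘ T a s`;
`PruneSol.mono`; `PruneSol.smul_witness` (cone-shaped `L s`: the constraints are projective in each unknown separately).
§2 MATRIX INSTANCE. `V = k^{m×n}`, `e = (· g)`, `g ∈ GL_n(k)` (`matMulRight`); operators = stacked LEFT multiplications `stackLeftMul`, which
commute with `e`: `matPruneSol_iff_image_mul_right` (right-translating every candidate set by `g` preserves solvability, any caps, any
left matrices) and `matPruneSol_iff_restrict` (IN-BRANCH ORBIT REPRESENTATIVES: if the cone-shaped lists are carried to themselves by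
every `g` of a set `G` of invertible matrices and `R` meets projectively the `G`-orbit of every candidate of term `s₁`, then
`SOL ⇔ SOL with W s₁ ∈ R` — fixing a class to orbit representatives loses no witness; iterate with the stabiliser of the representative).
§3 THE ω-LISTS. `omegaList P f Φ ω = {W : (∀ X, f X = 0 → X·W ∈ P) ∧ Φ (X ↦ ω(X·W))}` — footprint inside the type space `P` and an
ARBITRARY condition `Φ` on `X ↦ ω(X·W)` (ENG1: the ω-law `∀ X, ω(X W) − c_s(X) ω(W) = κ ψ_s(X)`; tensor: `φ_s^ω(W) = 0` / `φ_s^ω(W) ∥ d_s`).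
For `g` invertible with `P·g = P`: `(omegaList (ω ∘ (· g)))·g = omegaList ω` (`image_mul_right_omegaList`), hence THE THEOREM
`omegaSol_iff_comp_mulRight`: `SOL(ω) ⇔ SOL(ω ∘ (· g))`; with cone filters `SOL(c • (ω ∘ (· g))) ⇔ SOL(ω)`, `c ≠ 0`
(`omegaSol_iff_smul_comp_mulRight`: one representative per `K`-orbit of `P(P^*)`), and `omegaSol_iff_restrict` (orderly in-branch
symmetry with any `G ⊆ Stab(P)` fixing `ω` projectively; a smaller `G` only refines `R`, `G` need not be a group).
OUTSIDE Lean: that each engine enumerates exactly `PruneSol` of its printed constraint list (transcription; code + controls), that the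
sampled `g` satisfy the hypotheses (verified at run time), node counts, time-outs (an OPEN representative transfers nothing).
-/

namespace Summit.MatrixMultiplication.OmegaCensus.SmallFormats

open Module Matrix

/-! ## §1 Abstract prune systems and their transport along a linear automorphism -/

section Abstract

variable {k : Type*} [Field k] {V : Type*} [AddCommGroup V] [Module k V]
  {ι : Type*} {A : Type*} {U : A → Type*} [∀ a, AddCommGroup (U a)] [∀ a, Module k (U a)]

/-- **Solvability of an abstract prune system.** `PruneSol L T cap`: there is a tuple `W : ι → V` with `W s ∈ L s` for every `s`,
linearly independent, and obeying every rank cap `dim span {T a s (W s) : s ∈ ι} ≤ cap a`. -/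
def PruneSol (L : ι → Set V) (T : (a : A) → ι → (V →ₗ[k] U a)) (cap : A → ℕ) : Prop :=
  ∃ W : ι → V, (∀ s, W s ∈ L s) ∧ LinearIndependent k W ∧
    ∀ a, finrank k (Submodule.span k (Set.range fun s => T a s (W s))) ≤ cap a

/-- The rank of a capped family is unchanged when every member is moved by one linear automorphism of the target. -/
theorem finrank_span_range_comp_equiv {W' : Type*} [AddCommGroup W'] [Module k W'] (e : W' ≃ₗ[k] W') (v : ι → W') :
    finrank k (Submodule.span k (Set.range fun s => e (v s))) = finrank k (Submodule.span k (Set.range v)) := by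
  have hr : (Set.range fun s => e (v s)) = e '' Set.range v := by
    ext x; simp [Set.mem_range, Set.mem_image]
  rw [hr, ← LinearEquiv.coe_coe, ← Submodule.map_span, LinearEquiv.finrank_map_eq]

/-- **Transport of witnesses.** If `L' s = e '' L s` and the operators intertwine (`T' a s (e v) = e_a (T a s v)`), every witness `W`
of `(L, T, cap)` gives the witness `e ∘ W` of `(L', T', cap)`. -/
theorem PruneSol.transport (e : V ≃ₗ[k] V) (eU : ∀ a, U a ≃ₗ[k] U a)
    {L L' : ι → Set V} (hL : ∀ s, L' s = e '' L s)
    {T T' : (a : A) → ι → (V →ₗ[k] U a)} (hT : ∀ a s v, T' a s (e v) = eU a (T a s v)) {cap : A → ℕ}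
    (h : PruneSol L T cap) : PruneSol L' T' cap := by
  obtain ⟨W, hWL, hWind, hWcap⟩ := h
  refine ⟨fun s => e (W s), ?_, ?_, ?_⟩
  · intro s
    rw [hL s]; exact ⟨W s, hWL s, rfl⟩
  · exact hWind.map' (e : V →ₗ[k] V) e.ker
  · intro a
    have hfam : (fun s => T' a s (e (W s))) = fun s => eU a (T a s (W s)) := by
      funext s; exact hT a s (W s)
    rw [hfam, finrank_span_range_comp_equiv (eU a) (fun s => T a s (W s))]
    exact hWcap a

/-- **Solvability is invariant under transport** (both directions: apply `transport` to `e` and to `e⁻¹`). -/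
theorem pruneSol_iff_of_linearEquiv (e : V ≃ₗ[k] V) (eU : ∀ a, U a ≃ₗ[k] U a)
    {L L' : ι → Set V} (hL : ∀ s, L' s = e '' L s)
    {T T' : (a : A) → ι → (V →ₗ[k] U a)} (hT : ∀ a s v, T' a s (e v) = eU a (T a s v)) (cap : A → ℕ) :
    PruneSol L T cap ↔ PruneSol L' T' cap := by
  constructor
  · exact PruneSol.transport e eU hL hT
  · refine PruneSol.transport e.symm (fun a => (eU a).symm) ?_ ?_
    · intro s
      rw [hL s, ← Set.image_comp]
      ext x
      simp
    · intro a s v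
      have h := hT a s (e.symm v)
      rw [LinearEquiv.apply_symm_apply] at h
      rw [h, LinearEquiv.symm_apply_apply]


/-- **Shrinking candidate sets can only destroy witnesses** (`L' s ⊆ L s` for all `s`). -/
theorem PruneSol.mono {L L' : ι → Set V} (hLL : ∀ s, L' s ⊆ L s) {T : (a : A) → ι → (V →ₗ[k] U a)} {cap : A → ℕ}
    (h : PruneSol L' T cap) : PruneSol L T cap := by
  obtain ⟨W, hWL, hWind, hWcap⟩ := h
  exact ⟨W, fun s => hLL s (hWL s), hWind, hWcap⟩

/-- Rescaling every member of a family by units does not change its span. -/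
theorem span_range_smul_eq_of_ne_zero {W' : Type*} [AddCommGroup W'] [Module k W'] (c : ι → k) (hc : ∀ s, c s ≠ 0)
    (v : ι → W') : Submodule.span k (Set.range fun s => c s • v s) = Submodule.span k (Set.range v) := by
  apply le_antisymm
  · rw [Submodule.span_le]
    rintro _ ⟨s, rfl⟩
    exact Submodule.smul_mem _ _ (Submodule.subset_span ⟨s, rfl⟩)
  · rw [Submodule.span_le]
    rintro _ ⟨s, rfl⟩
    have h : v s = (c s)⁻¹ • (c s • v s) := by rw [smul_smul, inv_mul_cancel₀ (hc s), one_smul]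
    rw [h]
    exact Submodule.smul_mem _ _ (Submodule.subset_span ⟨s, rfl⟩)

/-- **Componentwise rescaling of a witness by units is a witness** when every candidate set is a cone
(`c ≠ 0 → v ∈ L s → c • v ∈ L s`): the constraints are projective in each unknown separately. -/
theorem PruneSol.smul_witness {L : ι → Set V} (hcone : ∀ s (c : k), c ≠ 0 → ∀ v ∈ L s, c • v ∈ L s)
    {T : (a : A) → ι → (V →ₗ[k] U a)} {cap : A → ℕ} {W : ι → V}
    (hWL : ∀ s, W s ∈ L s) (hWind : LinearIndependent k W)
    (hWcap : ∀ a, finrank k (Submodule.span k (Set.range fun s => T a s (W s))) ≤ cap a)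
    (c : ι → k) (hc : ∀ s, c s ≠ 0) :
    (∀ s, c s • W s ∈ L s) ∧ LinearIndependent k (fun s => c s • W s) ∧
      ∀ a, finrank k (Submodule.span k (Set.range fun s => T a s (c s • W s))) ≤ cap a := by
  refine ⟨fun s => hcone s (c s) (hc s) (W s) (hWL s), ?_, ?_⟩
  · exact hWind.units_smul fun s => Units.mk0 (c s) (hc s)
  · intro a
    have hfam : (fun s => T a s (c s • W s)) = fun s => c s • T a s (W s) := by
      funext s; rw [LinearMap.map_smul]
    rw [hfam, span_range_smul_eq_of_ne_zero c hc]
    exact hWcap a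

end Abstract

/-! ## §2 The matrix instance: right multiplication by `g ∈ GL_n(k)`, stacked left multiplications as the operators -/

section MatrixInstance

variable {k : Type*} [Field k] {m n : ℕ}

/-- Right multiplication by an invertible `n × n` matrix as a linear automorphism of `k^{m×n}` (inverse: right multiplication by `g⁻¹`). -/
noncomputable def matMulRight (g : Matrix (Fin n) (Fin n) k) (hg : IsUnit g.det) :
    Matrix (Fin m) (Fin n) k ≃ₗ[k] Matrix (Fin m) (Fin n) k where
  toFun W := W * g
  invFun W := W * g⁻¹
  map_add' A B := Matrix.add_mul A B g
  map_smul' a A := Matrix.smul_mul a A g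
  left_inv W := by
    show W * g * g⁻¹ = W
    rw [Matrix.mul_assoc, Matrix.mul_nonsing_inv g hg, Matrix.mul_one]
  right_inv W := by
    show W * g⁻¹ * g = W
    rw [Matrix.mul_assoc, Matrix.nonsing_inv_mul g hg, Matrix.mul_one]

/-- `matMulRight g hg W = W * g`. -/
@[simp] theorem matMulRight_apply (g : Matrix (Fin n) (Fin n) k) (hg : IsUnit g.det) (W : Matrix (Fin m) (Fin n) k) :
    matMulRight g hg W = W * g := rfl

/-- A STACKED LEFT-MULTIPLICATION operator `W ↦ (M i · W)_{i < p}` into `(k^{m×n})^p` (for `p = 1`: one left multiplication; the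
engines' footprints `(X_α − λ·1)·W`, the stacked triple `Φ(W)`, and the identity for the span test are all of this form). -/
def stackLeftMul {p : ℕ} (M : Fin p → Matrix (Fin m) (Fin m) k) :
    Matrix (Fin m) (Fin n) k →ₗ[k] (Fin p → Matrix (Fin m) (Fin n) k) where
  toFun W i := M i * W
  map_add' A B := by funext i; exact Matrix.mul_add (M i) A B
  map_smul' a A := by funext i; exact Matrix.mul_smul (M i) a A

/-- `stackLeftMul M W i = M i * W`. -/
@[simp] theorem stackLeftMul_apply {p : ℕ} (M : Fin p → Matrix (Fin m) (Fin m) k) (W : Matrix (Fin m) (Fin n) k) (i : Fin p) :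
    stackLeftMul M W i = M i * W := rfl

/-- Componentwise right multiplication on a stacked target. -/
noncomputable def stackMulRight (p : ℕ) (g : Matrix (Fin n) (Fin n) k) (hg : IsUnit g.det) :
    (Fin p → Matrix (Fin m) (Fin n) k) ≃ₗ[k] (Fin p → Matrix (Fin m) (Fin n) k) :=
  LinearEquiv.piCongrRight fun _ => matMulRight g hg

/-- Left families commute with right multiplication, stacked form: `stackLeftMul M (W g) = (stackLeftMul M W)·g` componentwise. -/
theorem stackLeftMul_mul_right {p : ℕ} (M : Fin p → Matrix (Fin m) (Fin m) k) (g : Matrix (Fin n) (Fin n) k) (hg : IsUnit g.det)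
    (W : Matrix (Fin m) (Fin n) k) :
    stackLeftMul M (matMulRight g hg W) = stackMulRight p g hg (stackLeftMul (n := n) M W) := by
  funext i
  simp [stackMulRight, Matrix.mul_assoc]

/-- **Solvability of a matrix prune system** with candidate sets `L s ⊆ k^{m×n}` and rank caps on stacked left-multiplication
families (`p a` rows of left matrices `M a s i` for cap `a`). -/
def MatPruneSol {ι A : Type*} (L : ι → Set (Matrix (Fin m) (Fin n) k)) (p : A → ℕ)
    (M : (a : A) → ι → Fin (p a) → Matrix (Fin m) (Fin m) k) (cap : A → ℕ) : Prop :=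
  PruneSol L (U := fun a => Fin (p a) → Matrix (Fin m) (Fin n) k) (fun a s => stackLeftMul (M a s)) cap

/-- **Right translation of all candidate sets by an invertible `g` preserves solvability**, for any caps and any left matrices. -/
theorem matPruneSol_iff_image_mul_right {ι A : Type*} (L : ι → Set (Matrix (Fin m) (Fin n) k)) (p : A → ℕ)
    (M : (a : A) → ι → Fin (p a) → Matrix (Fin m) (Fin m) k) (cap : A → ℕ)
    (g : Matrix (Fin n) (Fin n) k) (hg : IsUnit g.det) :
    MatPruneSol L p M cap ↔ MatPruneSol (fun s => (fun W : Matrix (Fin m) (Fin n) k => W * g) '' L s) p M cap := by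
  unfold MatPruneSol
  refine pruneSol_iff_of_linearEquiv (matMulRight g hg) (fun a => stackMulRight (p a) g hg) ?_ ?_ cap
  · intro s; rfl
  · intro a s v
    exact stackLeftMul_mul_right (M a s) g hg v


/-- **IN-BRANCH ORBIT REPRESENTATIVES (soundness of the orderly symmetry, EQUIVARIANCE.md §4).** If every candidate set is a cone
carried to itself by each `g` of a set `G` of invertible matrices, and `R` meets projectively the `G`-orbit of every candidate of term
`s₁` (`∀ v ∈ L s₁, ∃ g ∈ G, ∃ c ≠ 0, c • (v g) ∈ R`), then the system is solvable iff it is solvable with the EXTRA constraint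
`W s₁ ∈ R` (iterate with the stabiliser of the chosen representative, class by class). -/
theorem matPruneSol_iff_restrict {ι A : Type*} [DecidableEq ι] (L : ι → Set (Matrix (Fin m) (Fin n) k)) (p : A → ℕ)
    (M : (a : A) → ι → Fin (p a) → Matrix (Fin m) (Fin m) k) (cap : A → ℕ)
    (hcone : ∀ s (c : k), c ≠ 0 → ∀ v ∈ L s, c • v ∈ L s)
    (G : Set (Matrix (Fin n) (Fin n) k)) (hGdet : ∀ g ∈ G, IsUnit g.det)
    (hGL : ∀ g ∈ G, ∀ s, (fun W : Matrix (Fin m) (Fin n) k => W * g) '' L s = L s)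
    (s₁ : ι) (R : Set (Matrix (Fin m) (Fin n) k))
    (hR : ∀ v ∈ L s₁, ∃ g ∈ G, ∃ c : k, c ≠ 0 ∧ c • (v * g) ∈ R) :
    MatPruneSol L p M cap ↔ MatPruneSol (Function.update L s₁ (L s₁ ∩ R)) p M cap := by
  constructor
  · rintro ⟨W, hWL, hWind, hWcap⟩
    obtain ⟨g, hgG, c, hc, hcR⟩ := hR (W s₁) (hWL s₁)
    have hg := hGdet g hgG
    -- move the whole witness by `g` (the lists are `g`-stable), keeping track of the `s₁`-component
    let W₁ : ι → Matrix (Fin m) (Fin n) k := fun s => W s * g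
    have hW₁L : ∀ s, W₁ s ∈ L s := fun s => by
      rw [← hGL g hgG s]; exact ⟨W s, hWL s, rfl⟩
    have hW₁ind : LinearIndependent k W₁ := (linearIndependent_mul_right_iff g hg W).2 hWind
    have hW₁cap : ∀ a, finrank k (Submodule.span k (Set.range fun s => stackLeftMul (n := n) (M a s) (W₁ s))) ≤ cap a := by
      intro a
      have hfam : (fun s => stackLeftMul (n := n) (M a s) (W₁ s)) =
          fun s => stackMulRight (p a) g hg (stackLeftMul (n := n) (M a s) (W s)) := by
        funext s; exact stackLeftMul_mul_right (M a s) g hg (W s)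
      rw [hfam, finrank_span_range_comp_equiv (stackMulRight (p a) g hg)]
      exact hWcap a
    -- rescale the s₁-component by c
    let d : ι → k := fun s => if s = s₁ then c else 1
    have hd : ∀ s, d s ≠ 0 := fun s => by by_cases h : s = s₁ <;> simp [d, h, hc]
    obtain ⟨h2L, h2ind, h2cap⟩ := PruneSol.smul_witness (T := fun a s => stackLeftMul (n := n) (M a s)) hcone hW₁L hW₁ind
      hW₁cap d hd
    refine ⟨fun s => d s • W₁ s, ?_, h2ind, h2cap⟩
    intro s
    by_cases h : s = s₁
    · subst h
      rw [Function.update_self]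
      refine ⟨h2L s, ?_⟩
      simpa only [d, W₁, if_true] using hcR
    · rw [Function.update_of_ne h]; exact h2L s
  · intro h
    refine PruneSol.mono ?_ h
    intro s
    by_cases hs : s = s₁
    · subst hs; rw [Function.update_self]; exact Set.inter_subset_left
    · rw [Function.update_of_ne hs]

end MatrixInstance

/-! ## §3 The ω-filtered candidate lists and the equivariance theorem -/

section OmegaLists

variable {k : Type*} [Field k] {m n : ℕ}

/-- **The ω-filtered candidate list of one term.** `omegaList P f Φ ω = {W : (∀ X, f X = 0 → X·W ∈ P) ∧ Φ (X ↦ ω (X·W))}`: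
footprint of the left form `f` inside the type space `P`, and an arbitrary condition `Φ` on the values `ω(X·W)` (this covers the
ω-law filter of ENG1's `omega5` and the case-A / case-B filters `φ_s^ω(W) = 0`, `φ_s^ω(W) ∥ d_s` of tensor's `nearomega`). -/
def omegaList (P : Submodule k (Matrix (Fin m) (Fin n) k)) (f : Module.Dual k (Matrix (Fin m) (Fin m) k))
    (Φ : (Matrix (Fin m) (Fin m) k → k) → Prop) (ω : Module.Dual k (Matrix (Fin m) (Fin n) k)) :
    Set (Matrix (Fin m) (Fin n) k) :=
  {W | (∀ X : Matrix (Fin m) (Fin m) k, f X = 0 → X * W ∈ P) ∧ Φ (fun X => ω (X * W))}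

/-- The functional `ω` read through right multiplication by `g`: `Y ↦ ω (Y·g)`. -/
noncomputable def dualMulRight (ω : Module.Dual k (Matrix (Fin m) (Fin n) k)) (g : Matrix (Fin n) (Fin n) k) (hg : IsUnit g.det) :
    Module.Dual k (Matrix (Fin m) (Fin n) k) :=
  ω ∘ₗ (matMulRight (m := m) (n := n) g hg).toLinearMap

/-- `dualMulRight ω g hg Y = ω (Y * g)`. -/
@[simp] theorem dualMulRight_apply (ω : Module.Dual k (Matrix (Fin m) (Fin n) k)) (g : Matrix (Fin n) (Fin n) k)
    (hg : IsUnit g.det) (Y : Matrix (Fin m) (Fin n) k) : dualMulRight ω g hg Y = ω (Y * g) := rfl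

/-- **The lists are carried by the stabiliser:** for `g` invertible with `P·g ⊆ P` and `P·g⁻¹ ⊆ P` (i.e. `g ∈ Stab(P)`),
`omegaList P f Φ ω = (omegaList P f Φ (ω ∘ (· g)))·g`. -/
theorem image_mul_right_omegaList (P : Submodule k (Matrix (Fin m) (Fin n) k)) (g : Matrix (Fin n) (Fin n) k) (hg : IsUnit g.det)
    (hP : ∀ W ∈ P, W * g ∈ P) (hP' : ∀ W ∈ P, W * g⁻¹ ∈ P)
    (f : Module.Dual k (Matrix (Fin m) (Fin m) k)) (Φ : (Matrix (Fin m) (Fin m) k → k) → Prop)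
    (ω : Module.Dual k (Matrix (Fin m) (Fin n) k)) :
    (fun W : Matrix (Fin m) (Fin n) k => W * g) '' omegaList P f Φ (dualMulRight ω g hg) = omegaList P f Φ ω := by
  ext W
  constructor
  · rintro ⟨W₀, ⟨hW₀P, hW₀Φ⟩, rfl⟩
    refine ⟨candidate_mul_right_mem P g hP f hW₀P, ?_⟩
    have hfun : (fun X => ω (X * (W₀ * g))) = fun X => dualMulRight ω g hg (X * W₀) := by
      funext X; rw [dualMulRight_apply, Matrix.mul_assoc]
    rw [hfun]; exact hW₀Φ
  · rintro ⟨hWP, hWΦ⟩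
    refine ⟨W * g⁻¹, ⟨candidate_mul_right_mem P g⁻¹ hP' f hWP, ?_⟩, ?_⟩
    · have hfun : (fun X => dualMulRight ω g hg (X * (W * g⁻¹))) = fun X => ω (X * W) := by
        funext X
        rw [dualMulRight_apply, Matrix.mul_assoc, Matrix.mul_assoc, Matrix.nonsing_inv_mul g hg, Matrix.mul_one]
      rw [hfun]; exact hWΦ
    · show W * g⁻¹ * g = W
      rw [Matrix.mul_assoc, Matrix.nonsing_inv_mul g hg, Matrix.mul_one]

/-- **Solvability of the ω-branch system.** Terms `s : ι` with left forms `f s`, filters `Φ s`; rank caps `a : A` on stacked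
left-multiplication families `M a s`; the type space `P`; the branch functional `ω`. -/
def OmegaSol {ι A : Type*} (P : Submodule k (Matrix (Fin m) (Fin n) k)) (f : ι → Module.Dual k (Matrix (Fin m) (Fin m) k))
    (Φ : ι → (Matrix (Fin m) (Fin m) k → k) → Prop) (p : A → ℕ) (M : (a : A) → ι → Fin (p a) → Matrix (Fin m) (Fin m) k)
    (cap : A → ℕ) (ω : Module.Dual k (Matrix (Fin m) (Fin n) k)) : Prop :=
  MatPruneSol (fun s => omegaList P (f s) (Φ s) ω) p M cap

/-- **THE K-EQUIVARIANCE THEOREM.** For every invertible `g` stabilising the type space `P` (`P·g ⊆ P`, `P·g⁻¹ ⊆ P`):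
the ω-branch system is solvable for `ω` iff it is solvable for `ω ∘ (· g)` — same left data, same caps. (EQUIVARIANCE.md §3 /
RESULT-fp5 §3: one representative per `K`-orbit of branch functionals decides the whole orbit.) -/
theorem omegaSol_iff_comp_mulRight {ι A : Type*} (P : Submodule k (Matrix (Fin m) (Fin n) k))
    (f : ι → Module.Dual k (Matrix (Fin m) (Fin m) k)) (Φ : ι → (Matrix (Fin m) (Fin m) k → k) → Prop) (p : A → ℕ)
    (M : (a : A) → ι → Fin (p a) → Matrix (Fin m) (Fin m) k) (cap : A → ℕ) (ω : Module.Dual k (Matrix (Fin m) (Fin n) k))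
    (g : Matrix (Fin n) (Fin n) k) (hg : IsUnit g.det) (hP : ∀ W ∈ P, W * g ∈ P) (hP' : ∀ W ∈ P, W * g⁻¹ ∈ P) :
    OmegaSol P f Φ p M cap ω ↔ OmegaSol P f Φ p M cap (dualMulRight ω g hg) := by
  unfold OmegaSol
  rw [matPruneSol_iff_image_mul_right (fun s => omegaList P (f s) (Φ s) (dualMulRight ω g hg)) p M cap g hg]
  have hL : (fun s => (fun W : Matrix (Fin m) (Fin n) k => W * g) '' omegaList P (f s) (Φ s) (dualMulRight ω g hg)) =
      fun s => omegaList P (f s) (Φ s) ω := by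
    funext s; exact image_mul_right_omegaList P g hg hP hP' (f s) (Φ s) ω
  rw [hL]

/-- **Projective rescaling changes nothing** when every filter is a cone condition (`Φ s (c • v) ↔ Φ s v` for `c ≠ 0`; true for the
ω-law with `κ ↦ c κ` quantified inside `Φ`, for `φ = 0` and for `φ ∥ d`): `SOL(c • ω) ⇔ SOL(ω)`. -/
theorem omegaSol_smul_iff {ι A : Type*} (P : Submodule k (Matrix (Fin m) (Fin n) k))
    (f : ι → Module.Dual k (Matrix (Fin m) (Fin m) k)) (Φ : ι → (Matrix (Fin m) (Fin m) k → k) → Prop)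
    (hΦ : ∀ s (c : k) (v : Matrix (Fin m) (Fin m) k → k), c ≠ 0 → (Φ s (c • v) ↔ Φ s v)) (p : A → ℕ)
    (M : (a : A) → ι → Fin (p a) → Matrix (Fin m) (Fin m) k) (cap : A → ℕ) (ω : Module.Dual k (Matrix (Fin m) (Fin n) k))
    {c : k} (hc : c ≠ 0) :
    OmegaSol P f Φ p M cap (c • ω) ↔ OmegaSol P f Φ p M cap ω := by
  have hlist : ∀ s, omegaList P (f s) (Φ s) (c • ω) = omegaList P (f s) (Φ s) ω := by
    intro s
    ext W
    simp only [omegaList, Set.mem_setOf_eq, LinearMap.smul_apply]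
    have h := hΦ s c (fun X => ω (X * W)) hc
    exact and_congr_right fun _ => h
  unfold OmegaSol
  have hL : (fun s => omegaList P (f s) (Φ s) (c • ω)) = fun s => omegaList P (f s) (Φ s) ω := funext hlist
  rw [hL]

/-- **One representative per `K`-orbit of `P(P^*)`.** If `ω' = c • (ω ∘ (· g))` with `c ≠ 0` and `g ∈ Stab(P)` invertible, and the
filters are cone conditions, then `SOL(ω') ⇔ SOL(ω)`. -/
theorem omegaSol_iff_smul_comp_mulRight {ι A : Type*} (P : Submodule k (Matrix (Fin m) (Fin n) k))
    (f : ι → Module.Dual k (Matrix (Fin m) (Fin m) k)) (Φ : ι → (Matrix (Fin m) (Fin m) k → k) → Prop)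
    (hΦ : ∀ s (c : k) (v : Matrix (Fin m) (Fin m) k → k), c ≠ 0 → (Φ s (c • v) ↔ Φ s v)) (p : A → ℕ)
    (M : (a : A) → ι → Fin (p a) → Matrix (Fin m) (Fin m) k) (cap : A → ℕ) (ω : Module.Dual k (Matrix (Fin m) (Fin n) k))
    (g : Matrix (Fin n) (Fin n) k) (hg : IsUnit g.det) (hP : ∀ W ∈ P, W * g ∈ P) (hP' : ∀ W ∈ P, W * g⁻¹ ∈ P)
    {c : k} (hc : c ≠ 0) :
    OmegaSol P f Φ p M cap (c • dualMulRight ω g hg) ↔ OmegaSol P f Φ p M cap ω := by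
  rw [omegaSol_smul_iff P f Φ hΦ p M cap _ hc, ← omegaSol_iff_comp_mulRight P f Φ p M cap ω g hg hP hP']


/-- The ω-lists are cones when the filter is a cone condition. -/
theorem omegaList_smul_mem (P : Submodule k (Matrix (Fin m) (Fin n) k)) (f : Module.Dual k (Matrix (Fin m) (Fin m) k))
    (Φ : (Matrix (Fin m) (Fin m) k → k) → Prop) (hΦ : ∀ (c : k) (v : Matrix (Fin m) (Fin m) k → k), c ≠ 0 → (Φ (c • v) ↔ Φ v))
    (ω : Module.Dual k (Matrix (Fin m) (Fin n) k)) (c : k) (hc : c ≠ 0) :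
    ∀ W ∈ omegaList P f Φ ω, c • W ∈ omegaList P f Φ ω := by
  rintro W ⟨hWP, hWΦ⟩
  refine ⟨fun X hX => ?_, ?_⟩
  · rw [Matrix.mul_smul]; exact P.smul_mem c (hWP X hX)
  · have hfun : (fun X => ω (X * (c • W))) = c • fun X => ω (X * W) := by
      funext X; simp [Matrix.mul_smul]
    rw [hfun]; exact (hΦ c _ hc).2 hWΦ

/-- **The ω-lists are carried to themselves by the projective stabiliser of `ω` in `Stab(P)`:** if `g` is invertible, `P·g = P`,
and `ω(Y g) = c·ω(Y)` for all `Y` with `c ≠ 0`, then `(omegaList ω)·g = omegaList ω` (cone filters). -/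
theorem image_mul_right_omegaList_of_stab (P : Submodule k (Matrix (Fin m) (Fin n) k)) (g : Matrix (Fin n) (Fin n) k)
    (hg : IsUnit g.det) (hP : ∀ W ∈ P, W * g ∈ P) (hP' : ∀ W ∈ P, W * g⁻¹ ∈ P)
    (f : Module.Dual k (Matrix (Fin m) (Fin m) k)) (Φ : (Matrix (Fin m) (Fin m) k → k) → Prop)
    (hΦ : ∀ (c : k) (v : Matrix (Fin m) (Fin m) k → k), c ≠ 0 → (Φ (c • v) ↔ Φ v))
    (ω : Module.Dual k (Matrix (Fin m) (Fin n) k)) (c : k) (hc : c ≠ 0) (hstab : ∀ Y, ω (Y * g) = c * ω Y) :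
    (fun W : Matrix (Fin m) (Fin n) k => W * g) '' omegaList P f Φ ω = omegaList P f Φ ω := by
  have hω : dualMulRight ω g hg = c • ω := by
    ext Y; rw [dualMulRight_apply, hstab Y, LinearMap.smul_apply, smul_eq_mul]
  have hlist : omegaList P f Φ (dualMulRight ω g hg) = omegaList P f Φ ω := by
    rw [hω]; ext W
    simp only [omegaList, Set.mem_setOf_eq, LinearMap.smul_apply]
    exact and_congr_right fun _ => hΦ c (fun X => ω (X * W)) hc
  calc (fun W : Matrix (Fin m) (Fin n) k => W * g) '' omegaList P f Φ ω
        = (fun W : Matrix (Fin m) (Fin n) k => W * g) '' omegaList P f Φ (dualMulRight ω g hg) := by rw [hlist]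
    _ = omegaList P f Φ ω := image_mul_right_omegaList P g hg hP hP' f Φ ω

/-- **Orderly in-branch symmetry is sound for the ω-branch system.** With cone filters, a set `G ⊆ Stab(P)` of invertible matrices
fixing `ω` projectively, and a set `R` of representatives meeting (projectively) the `G`-orbit of every candidate of term `s₁`:
`SOL(ω) ⇔ SOL(ω) with W s₁ ∈ R`. -/
theorem omegaSol_iff_restrict {ι A : Type*} [DecidableEq ι] (P : Submodule k (Matrix (Fin m) (Fin n) k))
    (f : ι → Module.Dual k (Matrix (Fin m) (Fin m) k)) (Φ : ι → (Matrix (Fin m) (Fin m) k → k) → Prop)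
    (hΦ : ∀ s (c : k) (v : Matrix (Fin m) (Fin m) k → k), c ≠ 0 → (Φ s (c • v) ↔ Φ s v)) (p : A → ℕ)
    (M : (a : A) → ι → Fin (p a) → Matrix (Fin m) (Fin m) k) (cap : A → ℕ) (ω : Module.Dual k (Matrix (Fin m) (Fin n) k))
    (G : Set (Matrix (Fin n) (Fin n) k)) (hGdet : ∀ g ∈ G, IsUnit g.det)
    (hGP : ∀ g ∈ G, (∀ W ∈ P, W * g ∈ P) ∧ (∀ W ∈ P, W * g⁻¹ ∈ P))
    (hGω : ∀ g ∈ G, ∃ c : k, c ≠ 0 ∧ ∀ Y, ω (Y * g) = c * ω Y)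
    (s₁ : ι) (R : Set (Matrix (Fin m) (Fin n) k))
    (hR : ∀ v ∈ omegaList P (f s₁) (Φ s₁) ω, ∃ g ∈ G, ∃ c : k, c ≠ 0 ∧ c • (v * g) ∈ R) :
    OmegaSol P f Φ p M cap ω ↔
      MatPruneSol (Function.update (fun s => omegaList P (f s) (Φ s) ω) s₁ (omegaList P (f s₁) (Φ s₁) ω ∩ R)) p M cap := by
  unfold OmegaSol
  refine matPruneSol_iff_restrict (fun s => omegaList P (f s) (Φ s) ω) p M cap ?_ G hGdet ?_ s₁ R hR
  · intro s c hc v hv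
    exact omegaList_smul_mem P (f s) (Φ s) (hΦ s) ω c hc v hv
  · intro g hgG s
    obtain ⟨c, hc, hstab⟩ := hGω g hgG
    exact image_mul_right_omegaList_of_stab P g (hGdet g hgG) (hGP g hgG).1 (hGP g hgG).2 (f s) (Φ s) (hΦ s) ω c hc hstab

end OmegaLists

end Summit.MatrixMultiplication.OmegaCensus.SmallFormats
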